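import Summits.QuantumFields.YangMills.Theorems.UnitScaleTiltProp7CovariantInteriorHolderZd
import Literature.MathematicalPhysics.QuantumFieldTheory.Balaban1983to89.B9Eq343LocalHolderFlat
import HarnessLib

/-!
# Route `UnitScaleTilt`, crux K1 «MinimiserStabilityRegPr» (stmt-QuantumFields-19200), EX row (5) `h3` (STOREY H), H2 pipeline (ii) — programme **H2-LOC**, brick **(C5a):
# THE LOCAL η-SCALE ½-HÖLDER ESTIMATE FOR THE COVARIANT MASSIVE EQUATION ON A GENERAL TORUS `TSite d P`** — lit ✓`B9Eq343LocalHolderFlat.localHolder_flat_P`'s curved twin: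
# for unitary transporters `R(b)`, `S(b) = R(b)⁻¹` on `W` (the fibre `EuclideanSpace ℂ ι`, e.g. the member's `W₂ = EuclideanSpace ℂ (Fin 2 × Fin 2)`, read over `ℝ` through its `PiLp` real inner product), every solution of `covLaplaceSiteK K R S u + q = covDivL2K ℂ c₀ K S f`
# (scale `t = K ≥ 1`), every centre `x`, and LOCAL letters on the `tdist`-ball of radius `4K+1` about `x` — sups `M_u, M_f, M_q` and the transporter smallness `‖R(b)w − w‖ ≤ δ‖w‖`
# with `Kδ ≤ θ` —: `‖u(x′) − u(x)‖ ≤ C·(M_u + M_f + M_q)·(tdist(x,x′)∕K)^{½}` for `tdist(x,x′) ≤ K`; `C, θ` depend on `d` (and the fibre) only.  Lift to `ℤ^d` by lit ✓`exists_covering`,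
# read `W` over `ℝ`, apply (C4c) ✓`exists_covariant_interior_holder` with `κ = K⁻²`, `g = f∕K`, `src = (u − q)∕K²`; small scales `K ≤ 2` and `tdist = 0` are trivial.

Cell `ym3-torus` (HUMAN RULING D-0037; rung R3 = SU(2) YM₃ on T³ — NOT d = 4, NOT infinite volume, NOT a mass gap, NOT Clay).  Width seat `ym3-torus-px19` (gen 16);
`--supports stmt-QuantumFields-19200 --as helper`; count-neutral; THEOREMS ONLY (0 `def`, 0 `sorry`, default heartbeats).  Inputs BY NAME: (C4c) ✓`Prop7CovariantInteriorHolderZd.exists_covariant_interior_holder`,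
lit ✓`B9Eq343LocalHolderFlat.exists_covering`, ✓`B9Eq323KatoDomination.equiv_covLaplaceSiteK_eq_sum`, ✓`B11Eq103H1Complex.equiv_covDivL2K`, ✓`B9Eq33CovDerivVector.covDiv_apply`.

WHAT IS PROVED (ns `Summit.QuantumFields.YangMills.Theorems.Prop7CovariantLocalHolderTorus`; `d ≥ 1`).
* ★★★ `exists_covariant_localHolder_torus` (the `ℝ`-isometries of the fibre are built term-level inside the proof from the unitary pair `(R b, S b)` by `restrictScalars`) — THE ESTIMATE (`∃ C θ, 0 ≤ C ∧ 0 < θ ∧ ∀ P K ≥ 1, c₀, R S (unitary pair), u q f x (M_u M_f M_q δ ≥ 0), Kδ ≤ θ → equation →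
  local sups on the (4K+1)-ball → local transporter row → ∀ x′, tdist ≤ K → ‖u x′ − u x‖ ≤ C(M_u + M_f + M_q)(tdist∕K)^{½}`).
HYP-SAT (★★OWNER RULING №42): the unitary-pair rows are inhabited by `R = S = id` (`δ = 0`) and at the member by ✓`adBgInv_adBg`∕✓`norm_adBg_eq` (C5b); the equation and the sup rows
are (C5b)'s `covLapSite_eq`∕`hHlocV` binders.  HONEST SCOPE: [folklore] plumbing over (C4c); the member dictionary onto the frozen `hHlocV` text (857ccd79) is (C5b); nothing of `hWsup`, H2,
`h3`, norm_G, EX, 19200 or the rung is proved; the Yang–Mills mass gap is NOT proved.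

References: T. Bałaban, CMP **99** (1985) 389–434 [Balaban1985BackgroundPropagators] ((3.3) p.391, (3.8) p.392, (3.23) p.394, Thm 3.1 (3.43) p.398); CMP **96** (1984) 223–250
[Balaban1984PropagatorsII] ((1.9) p.226); M. Giaquinta, *Multiple integrals …* (1983) [Giaquinta1984] (Ch. III §2 Thm 2.2).
-/

set_option autoImplicit false

noncomputable section

open scoped BigOperators InnerProductSpace ComplexConjugate

namespace Summit.QuantumFields.YangMills.Theorems.Prop7CovariantLocalHolderTorus

open Literature.MathematicalPhysics.QuantumFieldTheory.Balaban1983to89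
open B4Sect5Torus (TSite tdist tdist_nonneg tdist_self ccoord)
open B9SectCLatticeCarrier (Bond bpos shift unshift)
open B9Eq311L2Pairing (WL2)
open B11Eq103H1Complex (SiteL2K BondL2K covDivL2K covLaplaceSiteK equiv_covDivL2K)
open B9Eq33CovDerivVector (covDiv_apply)
open B9Eq323KatoDomination (equiv_covLaplaceSiteK_eq_sum)
open B9Eq343LocalHolderFlat (exists_covering)
open B4Eq19LatticeOperators (Zd unitVec box mem_box box_mono self_mem_box)
open Summit.QuantumFields.YangMills.Theorems.Prop7CovariantInteriorHolderZd (exists_covariant_interior_holder)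

variable {d : ℕ} {ι : Type*} [Fintype ι]

/-! ## ★★★ The local estimate on a general torus -/

/-- ★★★ **THE LOCAL η-SCALE ½-HÖLDER ESTIMATE FOR THE COVARIANT MASSIVE LATTICE EQUATION ON A TORUS** ([Balaban1985BackgroundPropagators] Thm 3.1 (3.43) in LOCAL form at a curved
background).  There are `C, θ > 0` (depending on `d` and the fibre only) such that: for all periods `P`, scales `K ≥ 1`, weights `c₀`, `ℂ`-linear transporters `R, S` with
`S(b)R(b) = R(b)S(b) = 1`, `‖R(b)w‖ = ‖w‖`; all `u, q, f`, centres `x` and letters `M_u, M_f, M_q, δ ≥ 0` with `K·δ ≤ θ`: if `covLaplaceSiteK K R S u + q = covDivL2K ℂ c₀ K S f`,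
`‖u‖ ≤ M_u`, `‖f‖ ≤ M_f`, `‖q‖ ≤ M_q` and `‖R(y,μ)w − w‖ ≤ δ‖w‖` on the `tdist`-ball of radius `4K+1` about `x`, then for every `x′` with `tdist(x,x′) ≤ K`:
`‖u(x′) − u(x)‖ ≤ C·(M_u + M_f + M_q)·(tdist(x,x′)∕K)^{½}`. [folklore] [cite: Balaban1985BackgroundPropagators, Thm 3.1 (3.43) p.398, (3.23) p.394; Balaban1984PropagatorsII, (1.9) p.226;
Giaquinta1984, Ch. III §2 Thm 2.2 pp.78–79] -/
theorem exists_covariant_localHolder_torus (hd : 1 ≤ d) : ∃ C θ : ℝ, 0 ≤ C ∧ 0 < θ ∧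
    ∀ (P : Fin d → ℕ) [∀ i, NeZero (P i)] (K : ℕ), 1 ≤ K → ∀ (c₀ : ℝ) [Fact (0 < c₀)]
      (R S : Bond d P → (EuclideanSpace ℂ ι) →ₗ[ℂ] (EuclideanSpace ℂ ι)), (∀ b w, S b (R b w) = w) → (∀ b w, R b (S b w) = w) → (∀ b w, ‖R b w‖ = ‖w‖) →
      ∀ (u q : SiteL2K ℂ d P c₀ (EuclideanSpace ℂ ι)) (f : BondL2K ℂ d P c₀ (EuclideanSpace ℂ ι)) (x : TSite d P) (Mu Mf Mq δ : ℝ), 0 ≤ Mu → 0 ≤ Mf → 0 ≤ Mq → 0 ≤ δ → (K : ℝ) * δ ≤ θ →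
      covLaplaceSiteK (((K : ℝ) : ℂ)) R S u + q = covDivL2K ℂ c₀ (((K : ℝ) : ℂ)) S f →
      (∀ y, tdist P x y ≤ 4 * (K : ℝ) + 1 → ‖WL2.equiv ℂ (fun _ : TSite d P => c₀) (EuclideanSpace ℂ ι) u y‖ ≤ Mu) →
      (∀ (y : TSite d P) (μ : Fin d), tdist P x y ≤ 4 * (K : ℝ) + 1 → ‖WL2.equiv ℂ (fun _ : Bond d P => c₀) (EuclideanSpace ℂ ι) f (y, μ)‖ ≤ Mf) →
      (∀ y, tdist P x y ≤ 4 * (K : ℝ) + 1 → ‖WL2.equiv ℂ (fun _ : TSite d P => c₀) (EuclideanSpace ℂ ι) q y‖ ≤ Mq) →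
      (∀ (y : TSite d P) (μ : Fin d) (w : (EuclideanSpace ℂ ι)), tdist P x y ≤ 4 * (K : ℝ) + 1 → ‖R (y, μ) w - w‖ ≤ δ * ‖w‖) →
      ∀ x' : TSite d P, tdist P x x' ≤ (K : ℝ) →
        ‖WL2.equiv ℂ (fun _ : TSite d P => c₀) (EuclideanSpace ℂ ι) u x' - WL2.equiv ℂ (fun _ : TSite d P => c₀) (EuclideanSpace ℂ ι) u x‖ ≤ C * (Mu + Mf + Mq) * (tdist P x x' / (K : ℝ)) ^ ((1 : ℝ) / 2) := by
  classical
  obtain ⟨C₀, θ, hC₀, hθ, hZ⟩ := exists_covariant_interior_holder (W := EuclideanSpace ℂ ι) hd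
  refine ⟨2 * Real.sqrt 3 * C₀ + 4, θ, by positivity, hθ, ?_⟩
  intro P _ K hK1 c₀ _ R S hSR hRS hRn u q f x Mu Mf Mq δ hMu hMf hMq hδ hKδ hEq hbu hbf hbq hbR x' hxx'
  have hK0 : (0 : ℝ) < K := by exact_mod_cast hK1
  -- notation for the values
  set U : TSite d P → (EuclideanSpace ℂ ι) := fun y => WL2.equiv ℂ (fun _ : TSite d P => c₀) (EuclideanSpace ℂ ι) u y with hU
  set Q : TSite d P → (EuclideanSpace ℂ ι) := fun y => WL2.equiv ℂ (fun _ : TSite d P => c₀) (EuclideanSpace ℂ ι) q y with hQ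
  set Ff : Bond d P → (EuclideanSpace ℂ ι) := fun b => WL2.equiv ℂ (fun _ : Bond d P => c₀) (EuclideanSpace ℂ ι) f b with hFf
  have ht0 : 0 ≤ tdist P x x' / K := div_nonneg (tdist_nonneg P x x') hK0.le
  have hRHS0 : 0 ≤ (2 * Real.sqrt 3 * C₀ + 4) * (Mu + Mf + Mq) * (tdist P x x' / K) ^ ((1 : ℝ) / 2) :=
    mul_nonneg (mul_nonneg (by positivity) (by linarith only [hMu, hMf, hMq])) (Real.rpow_nonneg ht0 _)
  show ‖U x' - U x‖ ≤ (2 * Real.sqrt 3 * C₀ + 4) * (Mu + Mf + Mq) * (tdist P x x' / K) ^ ((1 : ℝ) / 2)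
  -- the covering and the two lifts
  obtain ⟨π, hπadd, hπsub, hπlip, hπlift⟩ := exists_covering P
  obtain ⟨a, ha, -⟩ := hπlift 0 x
  obtain ⟨a', ha', ha'box⟩ := hπlift a x'
  rw [ha] at ha'box
  set ρ₀ : ℕ := Finset.univ.sup (ccoord P x x') with hρ₀
  have htd : tdist P x x' = (ρ₀ : ℝ) := rfl
  -- the trivial case `tdist = 0`
  by_cases hρ0 : ρ₀ = 0
  · have hab : a' = a := by
      have := ha'box; rw [hρ0] at this
      funext i; have hi := (mem_box.1 this) i; simp only [Nat.cast_zero, abs_nonpos_iff, sub_eq_zero] at hi; exact hi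
    have hxx : x' = x := by rw [← ha', hab, ha]
    have h0 : U x' - U x = 0 := by rw [hxx, sub_self]
    rw [h0, norm_zero]; exact hRHS0
  have hρ₀1 : 1 ≤ ρ₀ := Nat.one_le_iff_ne_zero.2 hρ0
  have hρ₀K : ρ₀ ≤ K := by
    have : (ρ₀ : ℝ) ≤ K := by rw [← htd]; exact hxx'
    exact_mod_cast this
  have htd1 : (1 : ℝ) ≤ tdist P x x' := by rw [htd]; exact_mod_cast hρ₀1
  have hsqrt : Real.sqrt (tdist P x x' / K) = (tdist P x x' / K) ^ ((1 : ℝ) / 2) := Real.sqrt_eq_rpow _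
  -- small scales `K ≤ 2`: the trivial bound `2M_u`
  rcases lt_or_ge K 3 with hK3 | hK3
  · have hK2 : (K : ℝ) ≤ 2 := by exact_mod_cast (show K ≤ 2 by omega)
    have h1 : ‖U x' - U x‖ ≤ 2 * Mu := by
      have hx : tdist P x x ≤ 4 * (K : ℝ) + 1 := by rw [tdist_self]; positivity
      have hx' : tdist P x x' ≤ 4 * (K : ℝ) + 1 := hxx'.trans (by linarith only [hK0])
      calc ‖U x' - U x‖ ≤ ‖U x'‖ + ‖U x‖ := norm_sub_le _ _
        _ ≤ Mu + Mu := add_le_add (hbu x' hx') (hbu x hx)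
        _ = 2 * Mu := by ring
    have hhalf : (1 : ℝ) / 2 ≤ tdist P x x' / K := by rw [div_le_div_iff₀ (by norm_num) hK0]; linarith only [htd1, hK2]
    have ht1 : tdist P x x' / K ≤ 1 := by rw [div_le_one hK0]; exact hxx'
    have hsq : tdist P x x' / K ≤ (tdist P x x' / K) ^ ((1 : ℝ) / 2) := by
      rw [← hsqrt]
      calc tdist P x x' / K = Real.sqrt ((tdist P x x' / K) ^ 2) := (Real.sqrt_sq ht0).symm
        _ ≤ Real.sqrt (tdist P x x' / K) := Real.sqrt_le_sqrt (by nlinarith only [ht0, ht1])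
    have hC4 : 4 ≤ 2 * Real.sqrt 3 * C₀ + 4 := by linarith [show (0 : ℝ) ≤ 2 * Real.sqrt 3 * C₀ by positivity]
    have a1 : 4 * Mu ≤ (2 * Real.sqrt 3 * C₀ + 4) * (Mu + Mf + Mq) := mul_le_mul hC4 (by linarith only [hMf, hMq]) hMu (by positivity)
    have a2 : (1 : ℝ) / 2 ≤ (tdist P x x' / K) ^ ((1 : ℝ) / 2) := hhalf.trans hsq
    calc ‖U x' - U x‖ ≤ 2 * Mu := h1
      _ = 4 * Mu * (1 / 2) := by ring
      _ ≤ (2 * Real.sqrt 3 * C₀ + 4) * (Mu + Mf + Mq) * (tdist P x x' / K) ^ ((1 : ℝ) / 2) :=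
          mul_le_mul a1 a2 (by norm_num) ((by positivity : (0:ℝ) ≤ 4 * Mu).trans a1)
  -- THE MAIN CASE `K ≥ 3`: the `ℝ`-isometries and the lifted objects on `ℤ^d`
  have hKne : (K : ℝ) ≠ 0 := hK0.ne'
  let iso : Bond d P → ((EuclideanSpace ℂ ι) ≃ₗᵢ[ℝ] (EuclideanSpace ℂ ι)) := fun b =>
    ⟨LinearEquiv.ofLinear ((R b).restrictScalars ℝ) ((S b).restrictScalars ℝ) (by ext w; simp [hRS]) (by ext w; simp [hSR]), fun w => hRn b w⟩
  have iso_apply : ∀ (b : Bond d P) (w : (EuclideanSpace ℂ ι)), iso b w = R b w := fun b w => rfl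
  have iso_symm_apply : ∀ (b : Bond d P) (w : (EuclideanSpace ℂ ι)), (iso b).symm w = S b w := fun b w => by
    apply (iso b).injective
    rw [LinearIsometryEquiv.apply_symm_apply, iso_apply, hRS]
  set RZ : Zd d → Fin d → ((EuclideanSpace ℂ ι) ≃ₗᵢ[ℝ] (EuclideanSpace ℂ ι)) := fun y μ => iso (π y, μ) with hRZ
  set uZ : Zd d → (EuclideanSpace ℂ ι) := fun y => U (π y) with huZ
  set gZ : Zd d → Fin d → (EuclideanSpace ℂ ι) := fun y μ => (K : ℝ)⁻¹ • Ff (π y, μ) with hgZ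
  set sZ : Zd d → (EuclideanSpace ℂ ι) := fun y => ((K : ℝ)⁻¹) ^ 2 • (U (π y) - Q (π y)) with hsZ
  -- the pointwise torus equation in real scalars
  have hpt : ∀ y : TSite d P, ((K : ℝ) ^ 2) • (∑ ν, ((U y - S (unshift ν y, ν) (U (unshift ν y))) + (U y - R (y, ν) (U (shift ν y))))) + Q y
      = (K : ℝ) • ∑ ν, (S (unshift ν y, ν) (Ff (unshift ν y, ν)) - Ff (y, ν)) := by
    intro y
    have e := congr_arg (fun g => WL2.equiv ℂ _ (EuclideanSpace ℂ ι) g y) hEq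
    simp only [WL2.equiv_add, Pi.add_apply] at e
    have hs := equiv_covLaplaceSiteK_eq_sum (𝕜 := ℂ) (c₀ := c₀) (K : ℝ) R S hSR u y
    rw [RCLike.ofReal_eq_complex_ofReal] at hs
    rw [hs, equiv_covDivL2K, covDiv_apply] at e
    simp only [Complex.coe_smul, ← Finset.smul_sum] at e
    exact e
  -- the `ℤ^d` equation with `κ = K⁻²`, `g = f∕K`, `src = (u − q)∕K²`
  have hEqZ : ∀ y ∈ box a (4 * (K : ℤ)),
      (∑ μ, ((2 : ℝ) • uZ y - RZ y μ (uZ (y + unitVec μ)) - (RZ (y - unitVec μ) μ).symm (uZ (y - unitVec μ)))) + ((K : ℝ)⁻¹ ^ 2) • uZ y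
        = (∑ μ, ((RZ (y - unitVec μ) μ).symm (gZ (y - unitVec μ) μ) - gZ y μ)) + sZ y := by
    intro y _
    have h1 := hpt (π y)
    simp only [huZ, hgZ, hsZ, hRZ, iso_apply, iso_symm_apply, hπadd, hπsub]
    -- `A := Σ (2U − RU₊ − SU₋)`, `B := Σ (S F₋ − F)`
    set A : (EuclideanSpace ℂ ι) := ∑ μ, ((2 : ℝ) • U (π y) - R (π y, μ) (U (shift μ (π y))) - S (unshift μ (π y), μ) (U (unshift μ (π y)))) with hA
    set B : (EuclideanSpace ℂ ι) := ∑ μ, (S (unshift μ (π y), μ) (Ff (unshift μ (π y), μ)) - Ff (π y, μ)) with hB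
    have hA' : ∑ ν, ((U (π y) - S (unshift ν (π y), ν) (U (unshift ν (π y)))) + (U (π y) - R (π y, ν) (U (shift ν (π y))))) = A := by
      rw [hA]; refine Finset.sum_congr rfl fun ν _ => ?_; rw [two_smul]; abel
    rw [hA'] at h1
    -- `K²•A = K•B − Q`
    have h2 : A = ((K : ℝ)⁻¹ ^ 2) • ((K : ℝ) • B - Q (π y)) := by
      have e1 : ((K : ℝ) ^ 2) • A = (K : ℝ) • B - Q (π y) := by rw [← h1]; abel
      rw [← e1, smul_smul, inv_pow, inv_mul_cancel₀ (pow_ne_zero 2 hKne), one_smul]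
    have hB' : ∑ μ, (S (unshift μ (π y), μ) ((K : ℝ)⁻¹ • Ff (unshift μ (π y), μ)) - (K : ℝ)⁻¹ • Ff (π y, μ)) = (K : ℝ)⁻¹ • B := by
      rw [hB, Finset.smul_sum]
      refine Finset.sum_congr rfl fun μ _ => ?_
      rw [LinearMap.map_smul_of_tower, smul_sub]
    rw [hB', h2]
    have e3 : ((K : ℝ)⁻¹ ^ 2) • ((K : ℝ) • B - Q (π y)) = (K : ℝ)⁻¹ • B - ((K : ℝ)⁻¹ ^ 2) • Q (π y) := by
      rw [smul_sub, smul_smul, show (K : ℝ)⁻¹ ^ 2 * (K : ℝ) = (K : ℝ)⁻¹ by field_simp]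
    rw [e3, smul_sub]
    abel
  -- the bounds on `Q_{4K}(a)`
  have hdist : ∀ y ∈ box a (4 * (K : ℤ)), tdist P x (π y) ≤ 4 * (K : ℝ) + 1 := by
    intro y hy
    rw [← ha]
    have := hπlip a y (4 * (K : ℤ)) (by positivity) hy
    push_cast at this; linarith only [this]
  have huZb : ∀ y ∈ box a (4 * (K : ℤ)), ‖uZ y‖ ≤ Mu := fun y hy => hbu _ (hdist y hy)
  have hgZb : ∀ y ∈ box a (4 * (K : ℤ)), ∀ μ, ‖gZ y μ‖ ≤ Mf / K := fun y hy μ => by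
    simp only [hgZ]; rw [norm_smul, Real.norm_eq_abs, abs_of_pos (inv_pos.2 hK0), div_eq_inv_mul]
    exact mul_le_mul_of_nonneg_left (hbf _ μ (hdist y hy)) (inv_pos.2 hK0).le
  have hsZb : ∀ y ∈ box a (4 * (K : ℤ)), ‖sZ y‖ ≤ (Mu + Mq) / (K : ℝ) ^ 2 := fun y hy => by
    simp only [hsZ]; rw [norm_smul, Real.norm_eq_abs, abs_of_pos (by positivity), inv_pow, div_eq_inv_mul]
    refine mul_le_mul_of_nonneg_left ((norm_sub_le _ _).trans (add_le_add (hbu _ (hdist y hy)) (hbq _ (hdist y hy)))) (by positivity)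
  have hRZb : ∀ y ∈ box a (4 * (K : ℤ)), ∀ (μ : Fin d) (w : (EuclideanSpace ℂ ι)), ‖RZ y μ w - w‖ ≤ δ * ‖w‖ := fun y hy μ w => by
    simp only [hRZ, iso_apply]; exact hbR _ μ w (hdist y hy)
  -- the `ℤ^d` estimate
  have hmain := hZ RZ ((K : ℝ)⁻¹ ^ 2) (by positivity) uZ gZ sZ a K hK3 Mu (Mf / K) ((Mu + Mq) / (K : ℝ) ^ 2) δ hMu (by positivity) (by positivity) hδ hKδ
    hEqZ huZb hgZb hsZb hRZb ρ₀ hρ₀1 hρ₀K a' ha'box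
  have e1 : Mu + (K : ℝ) * (Mf / K) + (K : ℝ) ^ 2 * ((Mu + Mq) / (K : ℝ) ^ 2) = 2 * Mu + Mf + Mq := by field_simp; ring
  rw [e1] at hmain
  have e2 : uZ a' - uZ a = U x' - U x := by simp only [huZ, ha', ha]
  rw [e2] at hmain
  -- `√((2ρ₀+1)/K) ≤ √3 · (tdist/K)^{1/2}`
  have hρR : (1 : ℝ) ≤ ρ₀ := by exact_mod_cast hρ₀1
  have hle3 : (2 * (ρ₀ : ℝ) + 1) / (K : ℝ) ≤ 3 * (tdist P x x' / K) := by
    rw [htd, mul_div_assoc']; exact div_le_div_of_nonneg_right (by linarith only [hρR]) hK0.le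
  have hsq3 : Real.sqrt ((2 * (ρ₀ : ℝ) + 1) / (K : ℝ)) ≤ Real.sqrt 3 * (tdist P x x' / K) ^ ((1 : ℝ) / 2) := by
    calc Real.sqrt ((2 * (ρ₀ : ℝ) + 1) / (K : ℝ)) ≤ Real.sqrt (3 * (tdist P x x' / K)) := Real.sqrt_le_sqrt hle3
      _ = Real.sqrt 3 * Real.sqrt (tdist P x x' / K) := Real.sqrt_mul (by norm_num) _
      _ = Real.sqrt 3 * (tdist P x x' / K) ^ ((1 : ℝ) / 2) := by rw [hsqrt]
  have h2M : 2 * Mu + Mf + Mq ≤ 2 * (Mu + Mf + Mq) := by linarith only [hMf, hMq]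
  calc ‖U x' - U x‖ ≤ C₀ * (2 * Mu + Mf + Mq) * Real.sqrt ((2 * (ρ₀ : ℝ) + 1) / (K : ℝ)) := hmain
    _ ≤ C₀ * (2 * (Mu + Mf + Mq)) * (Real.sqrt 3 * (tdist P x x' / K) ^ ((1 : ℝ) / 2)) :=
        mul_le_mul (mul_le_mul_of_nonneg_left h2M hC₀) hsq3 (Real.sqrt_nonneg _) (by positivity)
    _ = (2 * Real.sqrt 3 * C₀) * (Mu + Mf + Mq) * (tdist P x x' / K) ^ ((1 : ℝ) / 2) := by ring
    _ ≤ (2 * Real.sqrt 3 * C₀ + 4) * (Mu + Mf + Mq) * (tdist P x x' / K) ^ ((1 : ℝ) / 2) := by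
        apply mul_le_mul_of_nonneg_right _ (Real.rpow_nonneg ht0 _)
        exact mul_le_mul_of_nonneg_right (by linarith only [hC₀]) (by linarith only [hMu, hMf, hMq])

end Summit.QuantumFields.YangMills.Theorems.Prop7CovariantLocalHolderTorus

end
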